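/-
Copyright (c) 2026 the pub-hodgecm-mathlib formalisation cell (harness21).  Prover seat hodgecm-mathlib-K2Liu-p08 (g2), Track B «K2-LIT»,
#184♮ = hLiu418 = `stmt-HodgeConjecture-24832`; K2E5-plan (g6) CO-DEAL 2026-09-04T07:39:22Z «§G1 RESIDUAL» (LEAD F0P6-plan (g12) 07:37:26Z (a)),
census `K2/K2Liu-p08/g2/CENSUS-G1END-ResidueLieDerivativeStandard.K2Liu-p08-g2.md` (q2).  First of the three G1-END files.
-/
import Summits.HodgeConjecture.HodgeConjecture.Theorems.K2LiuSiegelEisensteinDoubledSummable   -- ★ #9: the Godement chain (`parabolicIntegral`, …)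
import Summits.HodgeConjecture.HodgeConjecture.Theorems.K2LiuArchOneParameterOrbitDefs          -- ★ `archExp`, `continuous_archExp`
import HarnessLib

/-!
# Crux `HLiu418`, Road I v3, organ G1 (END): the SEGMENT-UNIFORM SUMMABLE MAJORANT of the Siegel Eisenstein terms
# (Weierstrass `M`-test shape, uniformly on compacta) on Godement's half-plane `Re s > n/2`

Cell `hodgecm-mathlib`, crux item hLiu418 = `stmt-HodgeConjecture-24832`; co-dealer K2E5-plan (g6), LEAD F0P6-plan (g12).  THEOREMS ONLY (no `def`,
no instance, no notation, no named-fact hypothesis, no `sorry`); lane `--supports stmt-HodgeConjecture-24832 --as helper` (count-neutral).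
Consumer: the G1-END file `K2LiuResidueLieDerivativeStandard` (hypothesis `hmaj` of ★ G1 file 3 `K2LiuEisensteinTermwiseLieDerivative`
`hasDerivAt_resNorm_orbit_of_termwise`), U5, Hol.

THE MATHEMATICS ([Garrett2018, §3.10, proof of Cor. 3.10.2]: «given compact `C`, `h(v) ≪_C h(v·g) ≪_C h(v)`»; [MoeglinWaldspurger1995, II.1.5]:
«the series converges normally on every compact subset»).  For a unitary `χ`, `Re s > n/2`, a CONTINUOUS Siegel section `f` of `I(s, χ)` on
`H(𝔸) = U(𝕍 ⊕ −𝕍)(𝔸)`, a base point `x₀ ∈ H(𝔸)` and a compact `C ⊆ H(𝔸)`, there is ONE summable `u : P_Δ(L⁺)\H(L⁺) → ℝ` with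
`‖f(γ_q · x₀ · c)‖ ≤ u_q` for ALL `c ∈ C` and all `q` — i.e. the sup over the compact sits INSIDE the sum (★ #9 gives the sum at each point; ★
`K2LiuSiegelEisensteinMajorantLocallyBounded` gives the sup OUTSIDE the sum).  Proof: ★ #9's Godement chain VERBATIM (an Iwasawa datum ★
`iwasawaDatumNonempty`, the continuous height `Φ` of ★ `exists_siegelHeight_continuous`, ★ `parabolicIntegral`, ★
`lintegral_siegelDomain_ne_top_of_parabolic`, ★ `summable_height_rpow_of_lintegral_ne_top` AT THE BASE POINT `x₀`), then ★ SMEAR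
`exists_smear_const_rpow` (`Φ(y c)^τ ≤ B Φ(y)^τ` for `c ∈ C`, ALL `y`) and ★ `norm_apply_le_of_decomp` (`‖f(y)‖ ≤ (B_f/c₀^τ) Φ(y)^τ`, `τ = 2 Re s + n`):
`u_q := (B_f/c₀^τ) · B · Φ(γ_q x₀)^τ`.

* §1 `exists_summable_majorant_on_compact` — the statement above;
* §2 `exists_summable_majorant_archOrbit` — the orbit-segment instance `C = γ_X([−R, R])` in the `hmaj` currency of ★ G1 file 3
  (`∀ t, |t| < R → ∀ q, ‖f(γ_q · (h₀ · γ_X t))‖ ≤ u q`, ★ `archExp`, ★ `continuous_archExp`).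

HONEST LABEL.  Count-neutral helper; `HC_CM` is proved only modulo the 7 printed citations (2 remaining named inputs: hLiu418 =
`stmt-HodgeConjecture-24832`, h413 = `stmt-HodgeConjecture-24833`) until rung 0 closes.
-/

set_option autoImplicit false
set_option linter.dupNamespace false -- the mandated namespace repeats `HodgeConjecture.HodgeConjecture`

noncomputable section

open scoped Matrix ENNReal NNReal
open NumberField NumberField.mixedEmbedding IsDedekindDomain MeasureTheory Measure Set

namespace Summit.HodgeConjecture.HodgeConjecture.Cruxes.HLiu418.K2LiuSiegelEisensteinMajorantCompact

open Literature.NumberTheory.Automorphic Literature.NumberTheory.Automorphic.UnitaryGroup Literature.NumberTheory.GaloisRepresentations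
open Literature.NumberTheory.GelbartRogawski1991 Literature.NumberTheory.GelbartRogawski1991.GRConstruction
open Literature.NumberTheory.K2Lit.SiegelDoubled
open Literature.MeasureTheory.Group
open Summit.HodgeConjecture.HodgeConjecture.Cruxes.HLiu418.K2LiuSiegelEisensteinDoubledSummableReduction
open Summit.HodgeConjecture.HodgeConjecture.Cruxes.HLiu418.K2LiuIwasawaDatumNonempty
open Summit.HodgeConjecture.HodgeConjecture.Cruxes.HLiu418.K2LiuSiegelDoubledHeightSmear
open Summit.HodgeConjecture.HodgeConjecture.Cruxes.HLiu418.K2LiuSiegelDoubledCountReduction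
open Summit.HodgeConjecture.HodgeConjecture.Cruxes.HLiu418.K2LiuSiegelDoubledParabolicReduction
open Summit.HodgeConjecture.HodgeConjecture.Cruxes.HLiu418.K2LiuSiegelDeltaHeightExists
open Summit.HodgeConjecture.HodgeConjecture.Cruxes.HLiu418.K2LiuSiegelDoubledUnfold
open Summit.HodgeConjecture.HodgeConjecture.Cruxes.HLiu418.K2LiuSiegelEisensteinDoubledSummable
open Summit.HodgeConjecture.HodgeConjecture.Cruxes.HLiu418.K2LiuArchOneParameterOrbitDefs

variable (L : Type) [Field L] [NumberField L] [IsCMField L]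
variable {N M n : ℕ} (e : Fin N × Fin M ≃ Fin n)
  (dV : Fin N → L) (hdV : ∀ i, IsCMField.complexConj L (dV i) = dV i) (hdV0 : ∀ i, dV i ≠ 0)
  (dW : Fin M → L) (hdW : ∀ i, IsCMField.complexConj L (dW i) = dW i) (hdW0 : ∀ i, dW i ≠ 0)

/-! ## §1 The `M`-test majorant, uniformly on a compact set of right translates -/

include hdV0 hdW0 in
/-- **THE SUMMABLE MAJORANT OF THE EISENSTEIN TERMS, UNIFORMLY ON COMPACTA.**  `χ` unitary, `Re s > n/2`, `f ∈ I(s, χ)` a continuous Siegel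
section, `x₀ ∈ H(𝔸)`, `C ⊆ H(𝔸)` compact: there is a summable `u` on `P_Δ(L⁺)\H(L⁺)` with `‖f(γ_q · (x₀ · c))‖ ≤ u q` for every `c ∈ C` and
every `q` (Godement's chain at `x₀` + the smearing comparison `Φ(y c) ≍_C Φ(y)`). [cite: Garrett2018, §3.10 (proof of Cor. 3.10.2)]
[cite: MoeglinWaldspurger1995, II.1.5] [cite: Liu2021, Lem. B.10 (2) p. 102] [cite: Tan1999, §1] -/
theorem exists_summable_majorant_on_compact {χ : HeckeCharacter L} (hχ : χ.IsUnitary) {s : ℂ} (hs : (n : ℝ) / 2 < s.re)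
    {f : HA L e dV hdV dW hdW → ℂ} (hf : IsSiegelDeltaSection L e dV hdV dW hdW χ s f) (hfc : Continuous f)
    (x₀ : HA L e dV hdV dW hdW) {C : Set (HA L e dV hdV dW hdW)} (hC : IsCompact C) :
    ∃ u : SiegelDeltaQuot L e dV hdV dW hdW → ℝ, Summable u ∧
      ∀ c ∈ C, ∀ q : SiegelDeltaQuot L e dV hdV dW hdW,
        ‖f (((Quotient.out q : ratH L e dV hdV dW hdW) : HA L e dV hdV dW hdW) * (x₀ * c))‖ ≤ u q := by
  -- Borel structure and a Haar measure on `H(𝔸)` (as in ★ #9)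
  letI : MeasurableSpace (HA L e dV hdV dW hdW) := borel _
  haveI : BorelSpace (HA L e dV hdV dW hdW) := ⟨rfl⟩
  let μ : Measure (HA L e dV hdV dW hdW) := Measure.haar
  -- the Iwasawa datum and the continuous height of record
  obtain ⟨𝒦⟩ := iwasawaDatumNonempty L e dV hdV hdV0 dW hdW hdW0
  obtain ⟨Φ, hΦc, hΦpos, hΦ, hΦK, hΦfloor⟩ := exists_siegelHeight_continuous L e dV hdV dW hdW hdV0 hdW0
  have hΦm : Measurable Φ := hΦc.measurable
  obtain ⟨c₀, hc₀, hc₀K⟩ := hΦK _ 𝒦.isCompact_K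
  set τ : ℝ := 2 * s.re + (n : ℝ) with hτdef
  have hτ : 2 * (n : ℝ) < τ := two_mul_lt_two_mul_re_add hs
  have hτ0 : 0 ≤ τ := (two_mul_re_add_pos (n := n) hs).le
  -- the parabolic integral and the Siegel-domain integral (Godement)
  obtain ⟨β', hβ'⟩ := exists_isCoveringWeight_siegelDeltaRat L e dV hdV dW hdW
  obtain ⟨μP, hμP, w₁, hw₁, hE5'⟩ := parabolicIntegral L e dV hdV dW hdW hdV0 hdW0 _ hτ
  have hE5 := lintegral_siegelDomain_ne_top_of_parabolic L e dV hdV dW hdW μ 𝒦 hΦm hΦpos hΦ hΦK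
    (upper_bound_of_floor L e dV hdV dW hdW hΦfloor) hτ0 μP hw₁ hE5' hβ'
  -- the height series at the base point `x₀` is summable
  have hsum : Summable (fun q : SiegelDeltaQuot L e dV hdV dW hdW =>
      Φ (((Quotient.out q : ratH L e dV hdV dW hdW) : HA L e dV hdV dW hdW) * x₀) ^ τ) :=
    summable_height_rpow_of_lintegral_ne_top L e dV hdV dW hdW μ 𝒦.isCompact_K 𝒦.iwasawa hΦm hΦpos hΦ hΦK hΦfloor hτ0 hβ' hE5 x₀
  -- smear: `Φ(y c)^τ ≤ B Φ(y)^τ` for `c ∈ C` and all `y`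
  obtain ⟨B, hB1, hB⟩ := exists_smear_const_rpow L e dV hdV dW hdW 𝒦.isCompact_K 𝒦.iwasawa hΦpos hΦ hΦK
    (upper_bound_of_floor L e dV hdV dW hdW hΦfloor) hC hτ0
  have hB0 : 0 ≤ B := le_trans zero_le_one hB1
  -- `f` is bounded on `K`
  obtain ⟨Bf, hBf⟩ := 𝒦.isCompact_K.exists_bound_of_continuousOn hfc.continuousOn
  have hBf' : ∀ k ∈ (𝒦.K : Set (HA L e dV hdV dW hdW)), ‖f k‖ ≤ max Bf 0 := fun k hk => (hBf k hk).trans (le_max_left _ _)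
  set A : ℝ := max Bf 0 / c₀ ^ τ with hAdef
  have hA0 : 0 ≤ A := div_nonneg (le_max_right _ _) (Real.rpow_nonneg hc₀.le τ)
  refine ⟨fun q => A * B * Φ (((Quotient.out q : ratH L e dV hdV dW hdW) : HA L e dV hdV dW hdW) * x₀) ^ τ,
    (hsum.mul_left (A * B)), fun c hc q => ?_⟩
  set y : HA L e dV hdV dW hdW := ((Quotient.out q : ratH L e dV hdV dW hdW) : HA L e dV hdV dW hdW) * x₀ with hy
  -- Iwasawa decomposition of the translate and the section bound
  obtain ⟨p, k, hp, hk, hpk⟩ := 𝒦.iwasawa (y * c)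
  have h1 : ‖f (y * c)‖ ≤ A * Φ (y * c) ^ τ :=
    norm_apply_le_of_decomp L e dV hdV dW hdW hχ hτ0 hf hBf' hΦpos hΦ hc₀ hc₀K hp hk hpk
  have h2 : Φ (y * c) ^ τ ≤ B * Φ y ^ τ := (hB y c hc).2
  calc ‖f (((Quotient.out q : ratH L e dV hdV dW hdW) : HA L e dV hdV dW hdW) * (x₀ * c))‖ = ‖f (y * c)‖ := by
        rw [hy, mul_assoc]
    _ ≤ A * Φ (y * c) ^ τ := h1
    _ ≤ A * (B * Φ y ^ τ) := mul_le_mul_of_nonneg_left h2 hA0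
    _ = A * B * Φ y ^ τ := by ring

include hdV0 hdW0 in
/-- the same majorant read at the points `x ∈ K′` of a compact `K′` (take `x₀ = 1`). [cite: Garrett2018, §3.10 (proof of Cor. 3.10.2)]
[cite: MoeglinWaldspurger1995, II.1.5] -/
theorem exists_summable_majorant_on_compact' {χ : HeckeCharacter L} (hχ : χ.IsUnitary) {s : ℂ} (hs : (n : ℝ) / 2 < s.re)
    {f : HA L e dV hdV dW hdW → ℂ} (hf : IsSiegelDeltaSection L e dV hdV dW hdW χ s f) (hfc : Continuous f)
    {K' : Set (HA L e dV hdV dW hdW)} (hK' : IsCompact K') :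
    ∃ u : SiegelDeltaQuot L e dV hdV dW hdW → ℝ, Summable u ∧
      ∀ x ∈ K', ∀ q : SiegelDeltaQuot L e dV hdV dW hdW,
        ‖f (((Quotient.out q : ratH L e dV hdV dW hdW) : HA L e dV hdV dW hdW) * x)‖ ≤ u q := by
  obtain ⟨u, hu, hb⟩ := exists_summable_majorant_on_compact L e dV hdV hdV0 dW hdW hdW0 hχ hs hf hfc 1 hK'
  exact ⟨u, hu, fun x hx q => by simpa only [one_mul] using hb x hx q⟩

/-! ## §2 The orbit-segment instance (the `hmaj` currency of ★ G1 file 3) -/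

include hdV0 hdW0 in
/-- **THE SEGMENT-UNIFORM MAJORANT ALONG AN ARCHIMEDEAN ONE-PARAMETER ORBIT** `t ↦ h₀ · γ_X(t)`, `γ_X = archExp … hX` (`X ∈ 𝔥_∞`): for `χ`
unitary, `Re s > n/2`, a continuous section `f ∈ I(s, χ)`, a base point `h₀` and a radius `R`, ONE summable `u` with
`‖f(γ_q · (h₀ · γ_X t))‖ ≤ u q` for all `|t| < R` and all `q` — verbatim the hypothesis `hmaj` (at this `s`) of ★
`K2LiuEisensteinTermwiseLieDerivative.hasDerivAt_resNorm_orbit_of_termwise` (`C := γ_X([−R, R])`, compact by ★ `continuous_archExp`).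
[cite: MoeglinWaldspurger1995, II.1.5, II.1.7] [cite: Garrett2018, §3.10 (proof of Cor. 3.10.2)] [cite: BorelJacquet1979, §4.1] -/
theorem exists_summable_majorant_archOrbit {χ : HeckeCharacter L} (hχ : χ.IsUnitary) {s : ℂ} (hs : (n : ℝ) / 2 < s.re)
    {f : HA L e dV hdV dW hdW → ℂ} (hf : IsSiegelDeltaSection L e dV hdV dW hdW χ s f) (hfc : Continuous f)
    (h₀ : HA L e dV hdV dW hdW) {X : Matrix (Fin (n + n)) (Fin (n + n)) (mixedSpace L)}
    (hX : X ∈ archSkew (Fp L) L (IsCMField.complexConj L) (n + n) (hermD L e dV hdV dW hdW)) (R : ℝ) :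
    ∃ u : SiegelDeltaQuot L e dV hdV dW hdW → ℝ, Summable u ∧
      ∀ t : ℝ, |t| < R → ∀ q : SiegelDeltaQuot L e dV hdV dW hdW,
        ‖f (((Quotient.out q : ratH L e dV hdV dW hdW) : HA L e dV hdV dW hdW) *
          (h₀ * archExp (Fp L) L (IsCMField.complexConj L) (n + n) (hermD L e dV hdV dW hdW) hX t))‖ ≤ u q := by
  have hC : IsCompact ((fun t : ℝ => archExp (Fp L) L (IsCMField.complexConj L) (n + n) (hermD L e dV hdV dW hdW) hX t) '' Icc (-R) R) :=
    (isCompact_Icc (a := -R) (b := R)).image (continuous_archExp (Fp L) L (IsCMField.complexConj L) (n + n) (hermD L e dV hdV dW hdW) hX)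
  obtain ⟨u, hu, hb⟩ := exists_summable_majorant_on_compact L e dV hdV hdV0 dW hdW hdW0 hχ hs hf hfc h₀ hC
  refine ⟨u, hu, fun t ht q => hb _ ?_ q⟩
  exact mem_image_of_mem _ ⟨(abs_lt.1 ht).1.le, (abs_lt.1 ht).2.le⟩

end Summit.HodgeConjecture.HodgeConjecture.Cruxes.HLiu418.K2LiuSiegelEisensteinMajorantCompact

end
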